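import Summits.QuantumFields.BalabanUV.T4Continuum.Support.BlockAverageQuadRemainder
import Summits.QuantumFields.BalabanUV.T4Continuum.Support.NE3TangentCovariantTower
import HarnessLib

/-!
# T⁴ programme, node NE3, route Π item Π-C (file Π-C-2) — THE k-FOLD RELATIVE LOG-COORDINATE OF THE AVERAGED VARIED CONFIGURATION
# `relIter L k W X` (the non-linear twin of `dirIter`), ITS ONE-STEP REMAINDER BY NAME, AND THE TELESCOPE

NE3 formalisation swarm `b2b-balaban-t4-ne3-formalise-*`, LEAF PROVER 02 (gen 7); route Π, item Π-C of the owner's design note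
`HOME/t4/b2b-balaban-t4-ne3-p1/g24/D-ne3p1-g24-1.md` §6 («kernel: leaf-02∕leaf-03 lineages»); SHAPE
`HOME/t4/b2b-balaban-t4-ne3-formalise-leaf-02/g7/PI-C-SHAPE-leaf02g7.md`; INTENT HOME/CLAIMS.log l.22318, owner GO l.22393.

OBJECTS (two DATA defs by structural recursion, inner-first exactly like the tree's `cavgIter`∕`dirIter`; no `def … : Prop`):
* `relStep L W X y κ := log((cavg L W y κ)⁻¹ · cavg L (vary W X 1) y κ)` — the RELATIVE log-coordinate of ONE averaging step of the varied
  configuration `W·e^{X}` against the average of `W`, read on the unit lattice (leaf-10's `BlockAverageVaryHolo.relAvg` at `q = L•y`, `σ = 1`);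
* `relIter L 0 W X = X`, `relIter L (j+1) W X = relIter L j (cavg L W) (relStep L W X)` — THE k-FOLD RELATIVE LOG-COORDINATE `Φ_W^{(k)}(X)`;
  its linear part is leaf-04's `dirIter L k W X` (same recursion with `cpush`), and the QUADRATIC REMAINDER `C_W^{(k)}(X)` of
  [Balaban1985Averaging] Prop. 4 (134)–(135) is the pointwise difference `relIter − dirIter` (no third definition).

CONTENT (all [folklore]; 0 sorry): §1 recursion (inner∕outer forms), flows (`cavgIter_shift`, `dirIter_shift`, `relIter_shift`); §2 ONE STEP BY
NAME — `norm_relStep_sub_cpush_le` (`‖relStep − cpush‖ ≤ 2(s∕rho0 d L)²` for `‖X‖ ≤ s ≤ rho0∕4`, = leaf-10's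
`BlockAverageQuadRemainder.norm_relLog_bavg_vary_sub_le` at `t = 1`), `norm_relUnit_sub_one_le_quarter`, `vary_cavg_relStep` (CONSISTENCY:
`vary (cavg L W) (relStep L W X) 1 = cavg L (vary W X 1)` — `MatrixLog.exp_mlog` in the ball), `relStep_skew`, `vary_add_period`, `relStep_add_period`;
§3 the tower under a level-wise regime hypothesis: `cavgIter_vary_eq_vary_relIter` (consistency at every level), `relIter_skew`, `relIter_periodic`;
§4 THE TELESCOPE: `relIter_succ_sub_dirIter_succ` (`R_{j+1} = E_j + cpush W_j R_j`, `cpush_add`) and its push toward a target level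
`dirIter_push_telescope` (`dirIter m W_{j+1} R_{j+1} = dirIter m W_{j+1} E_j + dirIter (m+1) W_j R_j`, `dirIter_add`) — (132)–(133) TYPE.

HONEST FRAMING.  Kinematics of the averaging map (42) on OUR frame (tree objects `cavg`∕`cpush`∕`dirIter`∕`vary`∕`mlog` BY NAME); the k-free BOUND
on the remainder is file Π-C-3; nothing about Bałaban's minimisers; `DecomposedRep`'s sizes, T-E_w♯, NE3 NOT proved; spine PROVED 0∕9; finite T⁴ rung
(B)+1 — NOT infinite volume, NOT mass gap, NOT BetaPertH, NOT Clay.  ABSOLUTE RULE kept (no printed sentence is a hypothesis; context only: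
[Balaban1985Averaging] (42) p. 23, Prop. 3 (122)–(123) p. 36, (127)–(135) pp. 37–38).  PLACEMENT: `Summits/QuantumFields/BalabanUV/`.
HONEST DEPENDENCY: continuum YM on T⁴ ⇐ BetaPertH ∧ nine spine estimates (0/9 proved); BetaPertH ⇐ (D1) ∧ (D4) ∧ CAP+tail; G-an2-4 gates asym, D1 and
NE2/3/4.
-/

set_option autoImplicit false

open scoped BigOperators Matrix.Norms.L2Operator
open NormedSpace Finset

namespace Summit.QuantumFields.BalabanUV.T4Continuum.NE3QuadRemainderTower

open Literature.MathematicalPhysics.QuantumFieldTheory.Balaban1983to89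
open B7Prop1Explicit B7Prop2Explicit MatrixLog
open T4AveragingDeficitWall (IsUnitaryCfg IsSkewDir SmallField vary)
open T4AveragingDeficitWallBoundary (IsPeriodicCfg)
open AveragingDeficitPeriodicCounting (IsPeriodicDir)
open AveragingDeficitChartCalculus (cavg)
open AveragingDeficitFermat (isPeriodicCfg_cavg)
open AveragingDeficitPlaqDeriv (vary_isUnitaryCfg)
open AveragingDeficitTwoLevelPrep (prop1Radius cavg_isUnitaryCfg)
open AveragingDeficitMultiLevelPrep (cpush cavgIter LevelSmall isPeriodicDir_cpush)
open AveragingDeficitResidualPairing (pushDir pushDir_mem_skewAdjoint)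
open BlockAverageVaryHolo (nbRad cvary relUnit cvary_ofReal)
open BlockAverageVaryDisc (rho0 rho0_pos norm_relUnit_sub_one_le)
open BlockAverageQuadRemainder (norm_relLog_bavg_vary_sub_le)
open NE3TangentCovariantStructure (norm_Wcx_sub_one_le_32 cpush_add)
open NE3TangentCovariantTower (dirIter dirIter_succ dirIter_succ' dirIter_zero dirIter_add cavgIter_succ')

noncomputable section

variable {d : ℕ} {n : Type*} [Fintype n] [DecidableEq n]

/-! ## §1 The objects and their recursion -/

/-- THE RELATIVE LOG-COORDINATE OF ONE AVERAGING STEP of the varied configuration `W·e^{X}` against the average of `W`, read on the unit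
lattice: `relStep L W X y κ := log((cavg L W y κ)⁻¹ · cavg L (vary W X 1) y κ)`. [cite: Balaban1985Averaging, (121)–(122) p.36] -/
def relStep (L : ℕ) (W : Site d → Fin d → (Matrix n n ℂ)ˣ) (X : Site d → Fin d → Matrix n n ℂ) : Site d → Fin d → Matrix n n ℂ :=
  fun y κ => mlog ((((cavg L W y κ)⁻¹ : (Matrix n n ℂ)ˣ) : Matrix n n ℂ) * ((cavg L (vary W X 1) y κ : (Matrix n n ℂ)ˣ) : Matrix n n ℂ))

/-- THE k-FOLD RELATIVE LOG-COORDINATE (inner-first, like `cavgIter`∕`dirIter`): `relIter L 0 W X = X`,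
`relIter L (j+1) W X = relIter L j (cavg L W) (relStep L W X)`. [cite: Balaban1985Averaging, (127) p.37, (134) p.38] -/
def relIter (L : ℕ) : ℕ → (Site d → Fin d → (Matrix n n ℂ)ˣ) → (Site d → Fin d → Matrix n n ℂ) → Site d → Fin d → Matrix n n ℂ
  | 0, _, X => X
  | j + 1, W, X => relIter L j (cavg L W) (relStep L W X)

/-- `relIter L 0 W X = X`. [folklore] -/
theorem relIter_zero (L : ℕ) (W : Site d → Fin d → (Matrix n n ℂ)ˣ) (X : Site d → Fin d → Matrix n n ℂ) : relIter L 0 W X = X := rfl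

/-- `relIter L (j+1) W X = relIter L j (cavg L W) (relStep L W X)`. [folklore] -/
theorem relIter_succ (L j : ℕ) (W : Site d → Fin d → (Matrix n n ℂ)ˣ) (X : Site d → Fin d → Matrix n n ℂ) :
    relIter L (j + 1) W X = relIter L j (cavg L W) (relStep L W X) := rfl

/-- `relIter L 1 W X = relStep L W X`. [folklore] -/
theorem relIter_one (L : ℕ) (W : Site d → Fin d → (Matrix n n ℂ)ˣ) (X : Site d → Fin d → Matrix n n ℂ) :
    relIter L 1 W X = relStep L W X := rfl

/-- Outer form: `relIter L (j+1) W X = relStep L (cavgIter L j W) (relIter L j W X)`. [folklore] -/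
theorem relIter_succ' (L : ℕ) : ∀ (j : ℕ) (W : Site d → Fin d → (Matrix n n ℂ)ˣ) (X : Site d → Fin d → Matrix n n ℂ),
    relIter L (j + 1) W X = relStep L (cavgIter L j W) (relIter L j W X)
  | 0, _, _ => rfl
  | j + 1, W, X => relIter_succ' L j (cavg L W) (relStep L W X)

/-- `relStep` unfolded at the block corner: `relStep L W X y κ = log((bavg L W (L•y) κ)⁻¹ · bavg L (vary W X 1) (L•y) κ)`. [folklore] -/
theorem relStep_eq (L : ℕ) (W : Site d → Fin d → (Matrix n n ℂ)ˣ) (X : Site d → Fin d → Matrix n n ℂ) (y : Site d) (κ : Fin d) :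
    relStep L W X y κ = mlog ((((bavg L W ((L : ℤ) • y) κ)⁻¹ : (Matrix n n ℂ)ˣ) : Matrix n n ℂ)
      * ((bavg L (vary W X 1) ((L : ℤ) • y) κ : (Matrix n n ℂ)ˣ) : Matrix n n ℂ)) := rfl

/-- `cpush` unfolded at the block corner: `cpush L W X y κ = pushDir L W X (L•y) κ`. [folklore] -/
theorem cpush_eq (L : ℕ) (W : Site d → Fin d → (Matrix n n ℂ)ˣ) (X : Site d → Fin d → Matrix n n ℂ) (y : Site d) (κ : Fin d) :
    cpush L W X y κ = pushDir L W X ((L : ℤ) • y) κ := rfl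

/-- `cavgIter` is a flow: `cavgIter L (m + i) W = cavgIter L i (cavgIter L m W)`. [folklore] -/
theorem cavgIter_shift (L : ℕ) : ∀ (m : ℕ) (i : ℕ) (W : Site d → Fin d → (Matrix n n ℂ)ˣ),
    cavgIter L (m + i) W = cavgIter L i (cavgIter L m W)
  | 0, i, W => by rw [Nat.zero_add]; rfl
  | m + 1, i, W => by
      rw [show m + 1 + i = (m + i) + 1 by omega]
      show cavgIter L (m + i) (cavg L W) = cavgIter L i (cavgIter L m (cavg L W))
      exact cavgIter_shift L m i (cavg L W)

/-- `dirIter` is a flow over `cavgIter`: `dirIter L (m + i) W Y = dirIter L i (cavgIter L m W) (dirIter L m W Y)`. [folklore] -/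
theorem dirIter_shift (L : ℕ) : ∀ (m : ℕ) (i : ℕ) (W : Site d → Fin d → (Matrix n n ℂ)ˣ) (Y : Site d → Fin d → Matrix n n ℂ),
    dirIter L (m + i) W Y = dirIter L i (cavgIter L m W) (dirIter L m W Y)
  | 0, i, W, Y => by rw [Nat.zero_add]; rfl
  | m + 1, i, W, Y => by
      rw [show m + 1 + i = (m + i) + 1 by omega]
      show dirIter L (m + i) (cavg L W) (cpush L W Y) = dirIter L i (cavgIter L m (cavg L W)) (dirIter L m (cavg L W) (cpush L W Y))
      exact dirIter_shift L m i (cavg L W) _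

/-- `relIter` is a flow over `cavgIter`: `relIter L (m + i) W X = relIter L i (cavgIter L m W) (relIter L m W X)`. [folklore] -/
theorem relIter_shift (L : ℕ) : ∀ (m : ℕ) (i : ℕ) (W : Site d → Fin d → (Matrix n n ℂ)ˣ) (X : Site d → Fin d → Matrix n n ℂ),
    relIter L (m + i) W X = relIter L i (cavgIter L m W) (relIter L m W X)
  | 0, i, W, X => by rw [Nat.zero_add]; rfl
  | m + 1, i, W, X => by
      rw [show m + 1 + i = (m + i) + 1 by omega]
      show relIter L (m + i) (cavg L W) (relStep L W X) = relIter L i (cavgIter L m (cavg L W)) (relIter L m (cavg L W) (relStep L W X))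
      exact relIter_shift L m i (cavg L W) _

/-! ## §2 One step: the remainder BY NAME, the disc, consistency, skewness, periodicity -/

/-- **THE ONE-STEP QUADRATIC REMAINDER BY NAME** (leaf-10's `BlockAverageQuadRemainder.norm_relLog_bavg_vary_sub_le` at `t = 1`): for a unitary
background of plaquette radius `a`, `512(d+1)(d+4)L²a ≤ 1`, and `‖X‖ ≤ s ≤ rho0 d L ∕ 4` everywhere,
`‖relStep L W X y κ − cpush L W X y κ‖ ≤ 2·(s ∕ rho0 d L)²`. [cite: Balaban1985Averaging, Prop. 3 (122)–(123) p.36] -/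
theorem norm_relStep_sub_cpush_le [Nonempty n] {L : ℕ} (hL : 1 ≤ L) {W : Site d → Fin d → (Matrix n n ℂ)ˣ} (hWu : IsUnitaryCfg W)
    {a : ℝ} (ha : 0 ≤ a) (hsmall : 512 * (d + 1) * (d + 4) * (L : ℝ) ^ 2 * a ≤ 1) (hWa : SmallField W a)
    {X : Site d → Fin d → Matrix n n ℂ} {s : ℝ} (hs : 0 ≤ s) (hX : ∀ (x : Site d) (μ : Fin d), ‖X x μ‖ ≤ s)
    (hsr : s ≤ rho0 d L / 4) (y : Site d) (κ : Fin d) :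
    ‖relStep L W X y κ - cpush L W X y κ‖ ≤ 2 * (s / rho0 d L) ^ 2 := by
  have h := norm_relLog_bavg_vary_sub_le hL hWu ha hsmall hWa (q := (L : ℤ) • y) hs (fun x μ _ => hX x μ) κ (t := 1)
    (by rw [abs_one, one_mul]; exact hsr)
  rw [one_smul, abs_one, one_mul] at h
  exact h

/-- The sup of the nonlinear coordinate after one step: `‖relStep L W X y κ‖ ≤ ‖cpush L W X y κ‖ + 2(s∕rho0)²`. [folklore] -/
theorem norm_relStep_le [Nonempty n] {L : ℕ} (hL : 1 ≤ L) {W : Site d → Fin d → (Matrix n n ℂ)ˣ} (hWu : IsUnitaryCfg W)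
    {a : ℝ} (ha : 0 ≤ a) (hsmall : 512 * (d + 1) * (d + 4) * (L : ℝ) ^ 2 * a ≤ 1) (hWa : SmallField W a)
    {X : Site d → Fin d → Matrix n n ℂ} {s : ℝ} (hs : 0 ≤ s) (hX : ∀ (x : Site d) (μ : Fin d), ‖X x μ‖ ≤ s)
    (hsr : s ≤ rho0 d L / 4) (y : Site d) (κ : Fin d) :
    ‖relStep L W X y κ‖ ≤ ‖cpush L W X y κ‖ + 2 * (s / rho0 d L) ^ 2 := by
  have h := norm_relStep_sub_cpush_le hL hWu ha hsmall hWa hs hX hsr y κ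
  have := norm_le_norm_add_norm_sub' (relStep L W X y κ) (cpush L W X y κ)
  calc ‖relStep L W X y κ‖ ≤ ‖cpush L W X y κ‖ + ‖relStep L W X y κ - cpush L W X y κ‖ := norm_le_insert' _ _
    _ ≤ _ := by linarith

/-- In the regime `s ≤ rho0 d L ∕ 4` one has `nbRad·(‖(1:ℂ)‖·s) ≤ 1∕128` (the disc hypothesis of leaf-10's `norm_relUnit_sub_one_le` at `σ = 1`).
[folklore] -/
theorem regime_one {L : ℕ} (hL : 1 ≤ L) {s : ℝ} (hsr : s ≤ rho0 d L / 4) :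
    (nbRad d L : ℝ) * (‖(1 : ℂ)‖ * s) ≤ 1 / 128 := by
  rw [norm_one, one_mul]
  have hnb : (0 : ℝ) < nbRad d L := by
    have := BlockAverageVaryDisc.two_le_nbRad (d := d) hL
    exact_mod_cast (by omega : 0 < nbRad d L)
  have e : rho0 d L = 1 / (128 * (nbRad d L : ℝ)) := rfl
  rw [e] at hsr
  calc (nbRad d L : ℝ) * s ≤ (nbRad d L : ℝ) * (1 / (128 * (nbRad d L : ℝ)) / 4) := mul_le_mul_of_nonneg_left hsr hnb.le
    _ = 1 / 512 := by field_simp; ring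
    _ ≤ 1 / 128 := by norm_num

/-- **THE DISC**: in the same regime the relative unit is within `1∕4` of `1` and every loop variable of the varied configuration within
`3∕64` of `1` (leaf-10's `norm_relUnit_sub_one_le` at `σ = 1`). [folklore] -/
theorem norm_relUnit_sub_one_le_quarter [Nonempty n] {L : ℕ} (hL : 1 ≤ L) {W : Site d → Fin d → (Matrix n n ℂ)ˣ} (hWu : IsUnitaryCfg W)
    {a : ℝ} (ha : 0 ≤ a) (hsmall : 512 * (d + 1) * (d + 4) * (L : ℝ) ^ 2 * a ≤ 1) (hWa : SmallField W a)
    {X : Site d → Fin d → Matrix n n ℂ} {s : ℝ} (hX : ∀ (x : Site d) (μ : Fin d), ‖X x μ‖ ≤ s)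
    (hsr : s ≤ rho0 d L / 4) (y : Site d) (κ : Fin d) :
    (∀ r : Fin d → Fin L, ‖((Wcx L (vary W X 1) ((L : ℤ) • y) κ (boxVec L r) : (Matrix n n ℂ)ˣ) : Matrix n n ℂ) - 1‖ ≤ 3 / 64) ∧
    ‖(((cavg L W y κ)⁻¹ : (Matrix n n ℂ)ˣ) : Matrix n n ℂ) * ((cavg L (vary W X 1) y κ : (Matrix n n ℂ)ˣ) : Matrix n n ℂ) - 1‖ ≤ 1 / 4 := by
  have h := norm_relUnit_sub_one_le hL hWu ha hsmall hWa (q := (L : ℤ) • y) (fun x μ _ => hX x μ) κ (σ := (1 : ℂ))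
    (regime_one hL hsr)
  have hc : cvary W X (1 : ℂ) = vary W X 1 := by rw [← Complex.ofReal_one, cvary_ofReal]
  obtain ⟨h1, h2⟩ := h
  unfold relUnit at h2
  rw [hc] at h1 h2
  exact ⟨h1, h2⟩

/-- **CONSISTENCY, ONE STEP**: in the regime, `vary (cavg L W) (relStep L W X) 1 = cavg L (vary W X 1)` — the relative log-coordinate
exponentiates back (`MatrixLog.exp_mlog` in the ball `‖u − 1‖ ≤ 1∕4 < 1`). [folklore] -/
theorem vary_cavg_relStep [Nonempty n] {L : ℕ} (hL : 1 ≤ L) {W : Site d → Fin d → (Matrix n n ℂ)ˣ} (hWu : IsUnitaryCfg W)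
    {a : ℝ} (ha : 0 ≤ a) (hsmall : 512 * (d + 1) * (d + 4) * (L : ℝ) ^ 2 * a ≤ 1) (hWa : SmallField W a)
    {X : Site d → Fin d → Matrix n n ℂ} {s : ℝ} (hX : ∀ (x : Site d) (μ : Fin d), ‖X x μ‖ ≤ s)
    (hsr : s ≤ rho0 d L / 4) : vary (cavg L W) (relStep L W X) 1 = cavg L (vary W X 1) := by
  funext y κ
  have hq := (norm_relUnit_sub_one_le_quarter hL hWu ha hsmall hWa hX hsr y κ).2
  refine Units.ext ?_
  simp only [vary, Units.val_mul, val_expUnit, Complex.ofReal_one, one_smul]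
  unfold relStep
  rw [exp_mlog (hq.trans_lt (by norm_num))]
  rw [← mul_assoc, Units.mul_inv, one_mul]

/-- **SKEWNESS**: for unitary `W` in the class and skew `X` in the regime, `relStep L W X` is skew (the relative unit is unitary — B7's
`bavg_mem_unitaryUnits` for both averages — and within `1∕4` of `1`, so its logarithm is skew-adjoint: `star_mlog_eq_neg`). [folklore] -/
theorem relStep_skew [Nonempty n] {L : ℕ} (hL : 1 ≤ L) {W : Site d → Fin d → (Matrix n n ℂ)ˣ} (hWu : IsUnitaryCfg W)
    {a : ℝ} (ha : 0 ≤ a) (hsmall : 512 * (d + 1) * (d + 4) * (L : ℝ) ^ 2 * a ≤ 1) (hWa : SmallField W a)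
    {X : Site d → Fin d → Matrix n n ℂ} (hXs : IsSkewDir X) {s : ℝ} (hX : ∀ (x : Site d) (μ : Fin d), ‖X x μ‖ ≤ s)
    (hsr : s ≤ rho0 d L / 4) : IsSkewDir (relStep L W X) := by
  letI : CStarAlgebra (Matrix n n ℂ) := {}
  intro y κ
  obtain ⟨hloop, hq⟩ := norm_relUnit_sub_one_le_quarter hL hWu ha hsmall hWa hX hsr y κ
  -- both averages are unitary
  have h1 : cavg L W y κ ∈ unitaryUnits (Matrix n n ℂ) := cavg_isUnitaryCfg hL hWu ha hsmall hWa y κ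
  have h2 : cavg L (vary W X 1) y κ ∈ unitaryUnits (Matrix n n ℂ) :=
    bavg_mem_unitaryUnits (vary_isUnitaryCfg hWu hXs 1) L ((L : ℤ) • y) κ fun r => (hloop r).trans (by norm_num)
  have hu : (((cavg L W y κ)⁻¹ : (Matrix n n ℂ)ˣ) : Matrix n n ℂ) * ((cavg L (vary W X 1) y κ : (Matrix n n ℂ)ˣ) : Matrix n n ℂ)
      ∈ unitary (Matrix n n ℂ) := by
    have h := (unitaryUnits (Matrix n n ℂ)).mul_mem ((unitaryUnits (Matrix n n ℂ)).inv_mem h1) h2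
    exact mem_unitaryUnits.mp h
  show relStep L W X y κ ∈ skewAdjoint (Matrix n n ℂ)
  rw [skewAdjoint.mem_iff]
  exact star_mlog_eq_neg hu hq

omit [Fintype n] [DecidableEq n] in
/-- Periodicity of the varied configuration: common period of `V` and `ψ`. [folklore] -/
theorem vary_add_period [Fintype n] [DecidableEq n] {V : Site d → Fin d → (Matrix n n ℂ)ˣ} {ψ : Site d → Fin d → Matrix n n ℂ} {P : ℤ}
    (hV : IsPeriodicCfg V P) (hψ : IsPeriodicDir ψ P) (s : ℝ) : IsPeriodicCfg (vary V ψ s) P := by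
  intro x κ μ
  simp only [vary, hV x κ μ, hψ x κ μ]

/-- **PERIODICITY**: `(L·P)`-periodic `W`, `X` give a `P`-periodic `relStep L W X`. [folklore] -/
theorem relStep_add_period (L P : ℕ) {W : Site d → Fin d → (Matrix n n ℂ)ˣ} {X : Site d → Fin d → Matrix n n ℂ}
    (hW : IsPeriodicCfg W ((L : ℤ) * P)) (hX : IsPeriodicDir X ((L : ℤ) * P)) : IsPeriodicDir (relStep L W X) (P : ℤ) := by
  intro y i κ
  have h1 := isPeriodicCfg_cavg L P hW y i κ
  have h2 := isPeriodicCfg_cavg L P (vary_add_period hW hX 1) y i κ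
  simp only [relStep, h1, h2]

/-- `cpush` of a skew direction at a unitary background in the class is skew (the tree's `pushDir_mem_skewAdjoint`). [folklore] -/
theorem cpush_skew [Nonempty n] {L : ℕ} (hL : 1 ≤ L) {W : Site d → Fin d → (Matrix n n ℂ)ˣ} (hWu : IsUnitaryCfg W)
    {a : ℝ} (ha : 0 ≤ a) (hsmall : 512 * (d + 1) * (d + 4) * (L : ℝ) ^ 2 * a ≤ 1) (hWa : SmallField W a)
    {Y : Site d → Fin d → Matrix n n ℂ} (hYs : IsSkewDir Y) : IsSkewDir (cpush L W Y) := by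
  intro y κ
  exact pushDir_mem_skewAdjoint L hWu hYs ((L : ℤ) • y) κ fun r =>
    (norm_Wcx_sub_one_le_32 hL hWu ha hsmall hWa _ κ r).trans_lt (by norm_num)

/-! ## §3 The tower under a level-wise regime -/

/-- THE LEVEL-WISE REGIME of the tower `(W, X)` up to level `j`: at every level `i < j` the background `cavgIter L i W` is unitary of some
plaquette radius `a_i ≥ 0` with `512(d+1)(d+4)L²a_i ≤ 1`, and the nonlinear coordinate `relIter L i W X` has a sup `t_i ≤ rho0 d L ∕ 4`
(a hypothesis SHAPE-free ∃-statement; discharged k-uniformly in file Π-C-3). [folklore] -/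
theorem regime_shift {L j : ℕ} {W : Site d → Fin d → (Matrix n n ℂ)ˣ} {X : Site d → Fin d → Matrix n n ℂ}
    (hreg : ∀ i < j + 1, ∃ a t : ℝ, 0 ≤ a ∧ 512 * (d + 1) * (d + 4) * (L : ℝ) ^ 2 * a ≤ 1 ∧ IsUnitaryCfg (cavgIter L i W)
      ∧ SmallField (cavgIter L i W) a ∧ 0 ≤ t ∧ (∀ (y : Site d) (κ : Fin d), ‖relIter L i W X y κ‖ ≤ t) ∧ t ≤ rho0 d L / 4) :
    ∀ i < j, ∃ a t : ℝ, 0 ≤ a ∧ 512 * (d + 1) * (d + 4) * (L : ℝ) ^ 2 * a ≤ 1 ∧ IsUnitaryCfg (cavgIter L i (cavg L W))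
      ∧ SmallField (cavgIter L i (cavg L W)) a ∧ 0 ≤ t ∧ (∀ (y : Site d) (κ : Fin d), ‖relIter L i (cavg L W) (relStep L W X) y κ‖ ≤ t)
      ∧ t ≤ rho0 d L / 4 :=
  fun i hi => hreg (i + 1) (by omega)

/-- **CONSISTENCY AT EVERY LEVEL**: under the level-wise regime, `cavgIter L j (vary W X 1) = vary (cavgIter L j W) (relIter L j W X) 1` — the
k-fold relative log-coordinate IS the log-coordinate of the k-fold average of `W·e^{X}` against the k-fold average of `W`.
[cite: Balaban1985Averaging, (127) p.37, (134) p.38] -/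
theorem cavgIter_vary_eq_vary_relIter [Nonempty n] {L : ℕ} (hL : 1 ≤ L) :
    ∀ (j : ℕ) {W : Site d → Fin d → (Matrix n n ℂ)ˣ} {X : Site d → Fin d → Matrix n n ℂ},
    (∀ i < j, ∃ a t : ℝ, 0 ≤ a ∧ 512 * (d + 1) * (d + 4) * (L : ℝ) ^ 2 * a ≤ 1 ∧ IsUnitaryCfg (cavgIter L i W)
      ∧ SmallField (cavgIter L i W) a ∧ 0 ≤ t ∧ (∀ (y : Site d) (κ : Fin d), ‖relIter L i W X y κ‖ ≤ t) ∧ t ≤ rho0 d L / 4) →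
    cavgIter L j (vary W X 1) = vary (cavgIter L j W) (relIter L j W X) 1
  | 0, _, _, _ => rfl
  | j + 1, W, X, hreg => by
      obtain ⟨a, t, ha, hsmall, hU, hS, ht, hXt, htr⟩ := hreg 0 (by omega)
      have h1 : cavg L (vary W X 1) = vary (cavg L W) (relStep L W X) 1 := (vary_cavg_relStep hL hU ha hsmall hS hXt htr).symm
      show cavgIter L j (cavg L (vary W X 1)) = vary (cavgIter L j (cavg L W)) (relIter L j (cavg L W) (relStep L W X)) 1
      rw [h1]
      exact cavgIter_vary_eq_vary_relIter hL j (regime_shift hreg)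

/-- **SKEWNESS AT EVERY LEVEL**: under the level-wise regime, skew `X` gives skew `relIter L j W X`. [folklore] -/
theorem relIter_skew [Nonempty n] {L : ℕ} (hL : 1 ≤ L) :
    ∀ (j : ℕ) {W : Site d → Fin d → (Matrix n n ℂ)ˣ} {X : Site d → Fin d → Matrix n n ℂ}, IsSkewDir X →
    (∀ i < j, ∃ a t : ℝ, 0 ≤ a ∧ 512 * (d + 1) * (d + 4) * (L : ℝ) ^ 2 * a ≤ 1 ∧ IsUnitaryCfg (cavgIter L i W)
      ∧ SmallField (cavgIter L i W) a ∧ 0 ≤ t ∧ (∀ (y : Site d) (κ : Fin d), ‖relIter L i W X y κ‖ ≤ t) ∧ t ≤ rho0 d L / 4) →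
    IsSkewDir (relIter L j W X)
  | 0, _, _, hXs, _ => hXs
  | j + 1, W, X, hXs, hreg => by
      obtain ⟨a, t, ha, hsmall, hU, hS, ht, hXt, htr⟩ := hreg 0 (by omega)
      exact relIter_skew hL j (relStep_skew hL hU ha hsmall hS hXs hXt htr) (regime_shift hreg)

/-- **PERIODICITY AT EVERY LEVEL**: period `L^j·P` of `W` and `X` gives period `P` of `relIter L j W X` (no regime needed). [folklore] -/
theorem relIter_periodic (L : ℕ) : ∀ (j : ℕ) (P : ℕ) {W : Site d → Fin d → (Matrix n n ℂ)ˣ} {X : Site d → Fin d → Matrix n n ℂ},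
    IsPeriodicCfg W ((L ^ j * P : ℕ) : ℤ) → IsPeriodicDir X ((L ^ j * P : ℕ) : ℤ) → IsPeriodicDir (relIter L j W X) (P : ℤ)
  | 0, P, _, _, _, hX => by rw [pow_zero, one_mul] at hX; exact hX
  | j + 1, P, W, X, hW, hX => by
      have e : ((L ^ (j + 1) * P : ℕ) : ℤ) = (L : ℤ) * ((L ^ j * P : ℕ) : ℤ) := by push_cast; ring
      rw [e] at hW hX
      exact relIter_periodic L j P (isPeriodicCfg_cavg L _ hW) (relStep_add_period L _ hW hX)

/-! ## §4 The telescope -/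

/-- **THE ONE-STEP TELESCOPE**: with `W_j := cavgIter L j W`, `X_j := relIter L j W X`, `D_j := dirIter L j W X`, `R_j := X_j − D_j` and the
one-step remainder `E_j := relStep L W_j X_j − cpush L W_j X_j` at level `j`:  `R_{j+1} = E_j + cpush L W_j R_j` (additivity of `cpush` in the
class at level `j`). [cite: Balaban1985Averaging, (132)–(133) p.38] -/
theorem relIter_succ_sub_dirIter_succ [Nonempty n] {L : ℕ} (hL : 1 ≤ L) (j : ℕ) {W : Site d → Fin d → (Matrix n n ℂ)ˣ}
    {a : ℝ} (hU : IsUnitaryCfg (cavgIter L j W)) (ha : 0 ≤ a) (hsmall : 512 * (d + 1) * (d + 4) * (L : ℝ) ^ 2 * a ≤ 1)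
    (hS : SmallField (cavgIter L j W) a) (X : Site d → Fin d → Matrix n n ℂ) (z : Site d) (κ : Fin d) :
    relIter L (j + 1) W X z κ - dirIter L (j + 1) W X z κ
      = (relStep L (cavgIter L j W) (relIter L j W X) z κ - cpush L (cavgIter L j W) (relIter L j W X) z κ)
        + cpush L (cavgIter L j W) (fun y μ => relIter L j W X y μ - dirIter L j W X y μ) z κ := by
  rw [relIter_succ', dirIter_succ']
  have hsplit : relIter L j W X = fun y μ => (relIter L j W X y μ - dirIter L j W X y μ) + dirIter L j W X y μ := by
    funext y μ; rw [sub_add_cancel]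
  have hadd := cpush_add hL hU ha hsmall hS (fun y μ => relIter L j W X y μ - dirIter L j W X y μ) (dirIter L j W X)
  have h2 : cpush L (cavgIter L j W) (relIter L j W X) z κ
      = cpush L (cavgIter L j W) (fun y μ => relIter L j W X y μ - dirIter L j W X y μ) z κ + cpush L (cavgIter L j W) (dirIter L j W X) z κ := by
    conv_lhs => rw [hsplit]
    rw [hadd]
  rw [h2]
  abel

/-- **THE TELESCOPE PUSHED TOWARD A TARGET LEVEL**: for every `m`, at the background `W_{j+1} = cavgIter L (j+1) W` in the class for `m` levels,
`dirIter L m W_{j+1} R_{j+1} = dirIter L m W_{j+1} E_j + dirIter L (m+1) W_j R_j` (pointwise; additivity of the `m`-fold linear tower and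
`dirIter (m+1) W_j = dirIter m W_{j+1} ∘ cpush W_j`). [cite: Balaban1985Averaging, (132)–(133) p.38] -/
theorem dirIter_push_telescope [Nonempty n] {L : ℕ} (hL : 1 ≤ L) (j m : ℕ) {W : Site d → Fin d → (Matrix n n ℂ)ˣ}
    {a : ℝ} (hU : IsUnitaryCfg (cavgIter L j W)) (ha : 0 ≤ a) (hsmall : 512 * (d + 1) * (d + 4) * (L : ℝ) ^ 2 * a ≤ 1)
    (hS : SmallField (cavgIter L j W) a)
    {x' : ℝ} (hU' : IsUnitaryCfg (cavgIter L (j + 1) W)) (hx' : 0 ≤ x') (hsm' : m = 0 ∨ LevelSmall d L (m - 1) x')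
    (hS' : SmallField (cavgIter L (j + 1) W) x') (X : Site d → Fin d → Matrix n n ℂ) (z : Site d) (κ : Fin d) :
    dirIter L m (cavgIter L (j + 1) W) (fun y μ => relIter L (j + 1) W X y μ - dirIter L (j + 1) W X y μ) z κ
      = dirIter L m (cavgIter L (j + 1) W)
          (fun y μ => relStep L (cavgIter L j W) (relIter L j W X) y μ - cpush L (cavgIter L j W) (relIter L j W X) y μ) z κ
        + dirIter L (m + 1) (cavgIter L j W) (fun y μ => relIter L j W X y μ - dirIter L j W X y μ) z κ := by
  -- the field identity `R_{j+1} = E_j + cpush W_j R_j`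
  have hfield : (fun y μ => relIter L (j + 1) W X y μ - dirIter L (j + 1) W X y μ)
      = fun y μ => (relStep L (cavgIter L j W) (relIter L j W X) y μ - cpush L (cavgIter L j W) (relIter L j W X) y μ)
          + cpush L (cavgIter L j W) (fun y' μ' => relIter L j W X y' μ' - dirIter L j W X y' μ') y μ := by
    funext y μ; exact relIter_succ_sub_dirIter_succ hL j hU ha hsmall hS X y μ
  rw [hfield]
  -- `dirIter (m+1) W_j R = dirIter m W_{j+1} (cpush W_j R)`
  have hsucc : dirIter L (m + 1) (cavgIter L j W) (fun y μ => relIter L j W X y μ - dirIter L j W X y μ)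
      = dirIter L m (cavgIter L (j + 1) W) (cpush L (cavgIter L j W) (fun y μ => relIter L j W X y μ - dirIter L j W X y μ)) := by
    rw [dirIter_succ, cavgIter_succ']
  rw [hsucc]
  -- additivity of the `m`-fold tower at `W_{j+1}`
  rcases m with _ | m
  · rfl
  · rcases hsm' with h0 | hsm'
    · exact absurd h0 (by omega)
    · rw [Nat.add_sub_cancel] at hsm'
      rw [dirIter_add hL m hU' hx' hsm' hS']

end

end Summit.QuantumFields.BalabanUV.T4Continuum.NE3QuadRemainderTower
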